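import Summits.AtomisticToContinuum.BoseEinsteinCondensation.Theorems.BECRieszReverseHolderCoarseRH2Toolkit
import Literature.MathematicalPhysics.QuantumManyBody.SwapPurity
import HarnessLib

/-!
# Route `BECRieszReverseHolder`, crux `CoarseGrainedReverseHolder` (stmt-AtomisticToContinuum-12840),
# line `registered`: the registered stub `stub_sliceLipschitz_of` (S1b)

Supports (does not close) stmt-AtomisticToContinuum-12840; stub `stub_sliceLipschitz_of` of the line
`registered` (`Cruxes/CoarseGrainedReverseHolder/Lines/registered.lean`).

**The coarse reverse-Hölder slice functional is `L²`-Lipschitz, given the finite-dimensional estimate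
S1a.** For `Ψ, Φ : (ℝ³)^{n+1} → ℂ` write `Ψ_X̂(y) = Ψ(y :: X̂)` for the slice at fixed environment
`X̂ ∈ (ℝ³)ⁿ` and, for the `m³` cubes `Q_k = BoseGas.subCell (L/m) k`,
`F(Ψ) := m³ ∫ dX̂ Σ_k (∫_{Q_k} |Ψ_X̂|²)² / ∫ |Ψ_X̂|²`. If `Φ` is measurable and normalised, `Ψ` a trial
state and `‖Ψ − Φ‖₂ ≤ η` (`η ≥ 0`), then `F(Ψ) ≤ F(Φ) + 8 m³ η`.

Proof. Pointwise in `X̂` apply S1a (the hypothesis) to the cube masses `a_k = ∫_{Q_k} |Ψ_X̂|²`,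
`b_k = ∫_{Q_k} |Φ_X̂|²` and the slice masses `A = ∫ |Ψ_X̂|²`, `B = ∫ |Φ_X̂|²` (`Σ a ≤ A`, `Σ b ≤ B`
because the cubes are disjoint, `BoseGas.sum_setLIntegral_subCell_le`; for `L/m ≤ 0` the cubes are
null). The error `2 Σ_k (a_k ∸ b_k) + (B ∸ A)` is at most `2 ∫ ((|Ψ_X̂|² ∸ |Φ_X̂|²) + (|Φ_X̂|² ∸ |Ψ_X̂|²))`
(`lintegral_sub_le'`), and pointwise `(s² ∸ t²) + (t² ∸ s²) = |s² − t²| ≤ |u − w| (|u| + |w|)` for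
`s = |u|`, `t = |w|`. Integrating in `X̂` (Tonelli along `Matrix.vecCons`,
`BoseGas.lintegral_config_succ`) and Cauchy–Schwarz (`BoseGas.lintegral_mul_sq_le`) give the total
error `2 m³ ∫ |Ψ − Φ| (|Ψ| + |Φ|) ≤ 2 m³ · η · (‖Ψ‖₂ + ‖Φ‖₂) = 4 m³ η ≤ 8 m³ η`.
-/

noncomputable section

open MeasureTheory Matrix
open scoped ENNReal NNReal BigOperators

namespace Summit.AtomisticToContinuum.BoseEinsteinCondensation.Theorems.CoarseGrainedReverseHolder

open Literature.MathematicalPhysics.QuantumManyBody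
open Literature.MathematicalPhysics.QuantumManyBody.BoseGas

namespace SliceLipschitz

/-- The scalar inequality behind `‖|u|² − |w|²‖ ≤ |u − w| (|u| + |w|)`, in `ℝ≥0` with truncated
subtraction: if `p ≤ q + d` and `q ≤ p + d` then `(p² ∸ q²) + (q² ∸ p²) ≤ d (p + q)`. -/
theorem sq_tsub_sq_add_le {p q d : ℝ≥0} (hp : p ≤ q + d) (hq : q ≤ p + d) :
    (p ^ 2 - q ^ 2) + (q ^ 2 - p ^ 2) ≤ d * (p + q) := by
  rcases le_total p q with h | h
  · rw [tsub_eq_zero_of_le (pow_le_pow_left' h 2), zero_add, sq_tsub_sq, mul_comm, add_comm p q]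
    gcongr
    exact tsub_le_iff_left.mpr hq
  · rw [tsub_eq_zero_of_le (pow_le_pow_left' h 2), add_zero, sq_tsub_sq, mul_comm]
    gcongr
    exact tsub_le_iff_left.mpr hp

/-- For complex `u, w`: `(|u|² ∸ |w|²) + (|w|² ∸ |u|²) ≤ |u − w| (|u| + |w|)` in `ℝ≥0∞`. -/
theorem nnnorm_sq_tsub_add_le (u w : ℂ) :
    ((‖u‖₊ : ℝ≥0∞) ^ 2 - (‖w‖₊ : ℝ≥0∞) ^ 2) + ((‖w‖₊ : ℝ≥0∞) ^ 2 - (‖u‖₊ : ℝ≥0∞) ^ 2) ≤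
      (‖u - w‖₊ : ℝ≥0∞) * ((‖u‖₊ : ℝ≥0∞) + ‖w‖₊) := by
  have h := sq_tsub_sq_add_le (nnnorm_le_nnnorm_add_nnnorm_sub' u w)
    (nnnorm_le_nnnorm_add_nnnorm_sub u w)
  exact_mod_cast h

/-- `Σ_q ∫_{Q_q} h ≤ ∫ h` over the sub-cells of side `ℓ`, for every real `ℓ` (disjoint cubes if
`ℓ > 0`, null cubes if `ℓ ≤ 0`). -/
theorem sum_setLIntegral_subCell_le_any (ℓ : ℝ) {m : ℕ} {h : Space → ℝ≥0∞}
    (hm : AEMeasurable h volume) :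
    ∑ q : SubIdx m, ∫⁻ x in subCell ℓ q, h x ≤ ∫⁻ x, h x := by
  by_cases hℓ : 0 < ℓ
  · exact sum_setLIntegral_subCell_le hℓ hm
  · have h0 : ∀ q : SubIdx m, ∫⁻ x in subCell ℓ q, h x = 0 := fun q =>
      setLIntegral_measure_zero _ _ (by
        rw [CoarseRH2.volume_subCell, ENNReal.ofReal_of_nonpos (not_lt.mp hℓ),
          zero_pow three_ne_zero])
    simp [h0]

/-- **The error term of S1a for two slices.** With `a_q = ∫_{Q_q} |F|²`, `b_q = ∫_{Q_q} |G|²`,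
`A = ∫ |F|²`, `B = ∫ |G|²`: `2 Σ_q (a_q ∸ b_q) + (B ∸ A) ≤ 2 ∫ |F − G| (|F| + |G|)`. -/
theorem error_le (ℓ : ℝ) (m : ℕ) {F G : Space → ℂ} (hF : Measurable F) (hG : Measurable G) :
    2 * ∑ q : SubIdx m, ((∫⁻ y in subCell ℓ q, (‖F y‖₊ : ℝ≥0∞) ^ 2) -
        ∫⁻ y in subCell ℓ q, (‖G y‖₊ : ℝ≥0∞) ^ 2) +
      ((∫⁻ y, (‖G y‖₊ : ℝ≥0∞) ^ 2) - ∫⁻ y, (‖F y‖₊ : ℝ≥0∞) ^ 2) ≤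
    2 * ∫⁻ y, (‖F y - G y‖₊ : ℝ≥0∞) * ((‖F y‖₊ : ℝ≥0∞) + ‖G y‖₊) := by
  have hF2 : Measurable fun y => (‖F y‖₊ : ℝ≥0∞) ^ 2 := hF.nnnorm.coe_nnreal_ennreal.pow_const 2
  have hG2 : Measurable fun y => (‖G y‖₊ : ℝ≥0∞) ^ 2 := hG.nnnorm.coe_nnreal_ennreal.pow_const 2
  have hFG : Measurable fun y => (‖F y‖₊ : ℝ≥0∞) ^ 2 - (‖G y‖₊ : ℝ≥0∞) ^ 2 := hF2.sub hG2
  have h1 : ∑ q : SubIdx m, ((∫⁻ y in subCell ℓ q, (‖F y‖₊ : ℝ≥0∞) ^ 2) -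
        ∫⁻ y in subCell ℓ q, (‖G y‖₊ : ℝ≥0∞) ^ 2) ≤
      ∫⁻ y, ((‖F y‖₊ : ℝ≥0∞) ^ 2 - (‖G y‖₊ : ℝ≥0∞) ^ 2) :=
    calc ∑ q : SubIdx m, ((∫⁻ y in subCell ℓ q, (‖F y‖₊ : ℝ≥0∞) ^ 2) -
          ∫⁻ y in subCell ℓ q, (‖G y‖₊ : ℝ≥0∞) ^ 2)
        ≤ ∑ q : SubIdx m, ∫⁻ y in subCell ℓ q, ((‖F y‖₊ : ℝ≥0∞) ^ 2 - (‖G y‖₊ : ℝ≥0∞) ^ 2) :=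
          Finset.sum_le_sum fun q _ => lintegral_sub_le' _ _ hG2.aemeasurable
      _ ≤ ∫⁻ y, ((‖F y‖₊ : ℝ≥0∞) ^ 2 - (‖G y‖₊ : ℝ≥0∞) ^ 2) :=
          sum_setLIntegral_subCell_le_any ℓ hFG.aemeasurable
  have h2 : (∫⁻ y, (‖G y‖₊ : ℝ≥0∞) ^ 2) - ∫⁻ y, (‖F y‖₊ : ℝ≥0∞) ^ 2 ≤
      ∫⁻ y, ((‖G y‖₊ : ℝ≥0∞) ^ 2 - (‖F y‖₊ : ℝ≥0∞) ^ 2) :=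
    lintegral_sub_le' _ _ hF2.aemeasurable
  have h3 : ∫⁻ y, ((‖G y‖₊ : ℝ≥0∞) ^ 2 - (‖F y‖₊ : ℝ≥0∞) ^ 2) ≤
      2 * ∫⁻ y, ((‖G y‖₊ : ℝ≥0∞) ^ 2 - (‖F y‖₊ : ℝ≥0∞) ^ 2) := by
    rw [two_mul]
    exact le_self_add
  calc 2 * ∑ q : SubIdx m, ((∫⁻ y in subCell ℓ q, (‖F y‖₊ : ℝ≥0∞) ^ 2) -
          ∫⁻ y in subCell ℓ q, (‖G y‖₊ : ℝ≥0∞) ^ 2) +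
        ((∫⁻ y, (‖G y‖₊ : ℝ≥0∞) ^ 2) - ∫⁻ y, (‖F y‖₊ : ℝ≥0∞) ^ 2)
      ≤ (2 * ∫⁻ y, ((‖F y‖₊ : ℝ≥0∞) ^ 2 - (‖G y‖₊ : ℝ≥0∞) ^ 2)) +
          2 * ∫⁻ y, ((‖G y‖₊ : ℝ≥0∞) ^ 2 - (‖F y‖₊ : ℝ≥0∞) ^ 2) :=
        add_le_add (mul_le_mul_right h1 2) (h2.trans h3)
    _ = 2 * ∫⁻ y, (((‖F y‖₊ : ℝ≥0∞) ^ 2 - (‖G y‖₊ : ℝ≥0∞) ^ 2) +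
          ((‖G y‖₊ : ℝ≥0∞) ^ 2 - (‖F y‖₊ : ℝ≥0∞) ^ 2)) := by
        rw [lintegral_add_left hFG, mul_add]
    _ ≤ 2 * ∫⁻ y, (‖F y - G y‖₊ : ℝ≥0∞) * ((‖F y‖₊ : ℝ≥0∞) + ‖G y‖₊) :=
        mul_le_mul_right (lintegral_mono fun y => nnnorm_sq_tsub_add_le (F y) (G y)) 2

/-- **The coarse RH₂ functional is `L²`-Lipschitz (cube side `ℓ`, any prefactor `m³`), given S1a.**
For measurable normalised `Ψ, Φ : (ℝ³)^{n+1} → ℂ` with `∫ |Ψ − Φ|² ≤ η²` (`η ≥ 0`):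
`m³ ∫ dX̂ Σ_k (∫_{Q_k}|Ψ_X̂|²)² / ∫|Ψ_X̂|² ≤ m³ ∫ dX̂ Σ_k (∫_{Q_k}|Φ_X̂|²)² / ∫|Φ_X̂|² + 8 m³ η`. -/
theorem coarseRH2_lipschitz
    (hS1a : ∀ (ι : Type) [Fintype ι] (a b : ι → ℝ≥0∞) (A B : ℝ≥0∞),
      ∑ k, a k ≤ A → ∑ k, b k ≤ B →
      (∑ k, a k ^ 2) / A ≤ (∑ k, b k ^ 2) / B + (2 * ∑ k, (a k - b k) + (B - A)))
    {n : ℕ} (ℓ : ℝ) (m : ℕ) {η : ℝ} (hη : 0 ≤ η) {Ψ Φ : Config (n + 1) → ℂ}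
    (hΨm : Measurable Ψ) (hΦm : Measurable Φ)
    (hΨ1 : ∫⁻ Z, (‖Ψ Z‖₊ : ℝ≥0∞) ^ 2 = 1) (hΦ1 : ∫⁻ Z, (‖Φ Z‖₊ : ℝ≥0∞) ^ 2 = 1)
    (hclose : ∫⁻ Z, (‖Ψ Z - Φ Z‖₊ : ℝ≥0∞) ^ 2 ≤ ENNReal.ofReal (η ^ 2)) :
    (m : ℝ≥0∞) ^ 3 * ∫⁻ X : Config n,
        (∑ k : SubIdx m, (∫⁻ y in subCell ℓ k, (‖Ψ (Matrix.vecCons y X)‖₊ : ℝ≥0∞) ^ 2) ^ 2) /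
          (∫⁻ y, (‖Ψ (Matrix.vecCons y X)‖₊ : ℝ≥0∞) ^ 2) ≤
      ((m : ℝ≥0∞) ^ 3 * ∫⁻ X : Config n,
        (∑ k : SubIdx m, (∫⁻ y in subCell ℓ k, (‖Φ (Matrix.vecCons y X)‖₊ : ℝ≥0∞) ^ 2) ^ 2) /
          (∫⁻ y, (‖Φ (Matrix.vecCons y X)‖₊ : ℝ≥0∞) ^ 2)) +
      ENNReal.ofReal (8 * (m : ℝ) ^ 3 * η) := by
  -- measurability of the slices and of the error density `|Ψ − Φ| (|Ψ| + |Φ|)`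
  have hΨs : ∀ X : Config n, Measurable fun y : Space => Ψ (Matrix.vecCons y X) :=
    fun X => measurable_comp_vecCons_left hΨm X
  have hΦs : ∀ X : Config n, Measurable fun y : Space => Φ (Matrix.vecCons y X) :=
    fun X => measurable_comp_vecCons_left hΦm X
  have hD : Measurable fun Z => (‖Ψ Z - Φ Z‖₊ : ℝ≥0∞) := (hΨm.sub hΦm).nnnorm.coe_nnreal_ennreal
  have hNΨ : Measurable fun Z => (‖Ψ Z‖₊ : ℝ≥0∞) := hΨm.nnnorm.coe_nnreal_ennreal
  have hNΦ : Measurable fun Z => (‖Φ Z‖₊ : ℝ≥0∞) := hΦm.nnnorm.coe_nnreal_ennreal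
  have hGm : Measurable fun Z => (‖Ψ Z - Φ Z‖₊ : ℝ≥0∞) * ((‖Ψ Z‖₊ : ℝ≥0∞) + ‖Φ Z‖₊) :=
    hD.mul (hNΨ.add hNΦ)
  have hGs : Measurable fun X : Config n => ∫⁻ y : Space,
      (‖Ψ (Matrix.vecCons y X) - Φ (Matrix.vecCons y X)‖₊ : ℝ≥0∞) *
        ((‖Ψ (Matrix.vecCons y X)‖₊ : ℝ≥0∞) + ‖Φ (Matrix.vecCons y X)‖₊) :=
    (hGm.comp measurable_vecCons).lintegral_prod_left'
  have hGs2 : Measurable fun X : Config n => 2 * ∫⁻ y : Space,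
      (‖Ψ (Matrix.vecCons y X) - Φ (Matrix.vecCons y X)‖₊ : ℝ≥0∞) *
        ((‖Ψ (Matrix.vecCons y X)‖₊ : ℝ≥0∞) + ‖Φ (Matrix.vecCons y X)‖₊) := hGs.const_mul 2
  -- pointwise in the environment `X̂`: S1a plus the error estimate
  have hpt : ∀ X : Config n,
      (∑ k : SubIdx m, (∫⁻ y in subCell ℓ k, (‖Ψ (Matrix.vecCons y X)‖₊ : ℝ≥0∞) ^ 2) ^ 2) /
          (∫⁻ y, (‖Ψ (Matrix.vecCons y X)‖₊ : ℝ≥0∞) ^ 2) ≤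
        (∑ k : SubIdx m, (∫⁻ y in subCell ℓ k, (‖Φ (Matrix.vecCons y X)‖₊ : ℝ≥0∞) ^ 2) ^ 2) /
            (∫⁻ y, (‖Φ (Matrix.vecCons y X)‖₊ : ℝ≥0∞) ^ 2) +
          2 * ∫⁻ y : Space, (‖Ψ (Matrix.vecCons y X) - Φ (Matrix.vecCons y X)‖₊ : ℝ≥0∞) *
            ((‖Ψ (Matrix.vecCons y X)‖₊ : ℝ≥0∞) + ‖Φ (Matrix.vecCons y X)‖₊) := by
    intro X
    have hA := sum_setLIntegral_subCell_le_any ℓ (m := m)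
      ((hΨs X).nnnorm.coe_nnreal_ennreal.pow_const 2).aemeasurable
    have hB := sum_setLIntegral_subCell_le_any ℓ (m := m)
      ((hΦs X).nnnorm.coe_nnreal_ennreal.pow_const 2).aemeasurable
    have hE := error_le ℓ m (hΨs X) (hΦs X)
    exact (hS1a (SubIdx m) _ _ _ _ hA hB).trans (add_le_add le_rfl hE)
  -- integrate in `X̂` and use Tonelli along `Matrix.vecCons`
  have hint : ∫⁻ X : Config n,
        (∑ k : SubIdx m, (∫⁻ y in subCell ℓ k, (‖Ψ (Matrix.vecCons y X)‖₊ : ℝ≥0∞) ^ 2) ^ 2) /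
          (∫⁻ y, (‖Ψ (Matrix.vecCons y X)‖₊ : ℝ≥0∞) ^ 2) ≤
      (∫⁻ X : Config n,
        (∑ k : SubIdx m, (∫⁻ y in subCell ℓ k, (‖Φ (Matrix.vecCons y X)‖₊ : ℝ≥0∞) ^ 2) ^ 2) /
          (∫⁻ y, (‖Φ (Matrix.vecCons y X)‖₊ : ℝ≥0∞) ^ 2)) +
        2 * ∫⁻ Z, (‖Ψ Z - Φ Z‖₊ : ℝ≥0∞) * ((‖Ψ Z‖₊ : ℝ≥0∞) + ‖Φ Z‖₊) := by
    calc ∫⁻ X : Config n,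
          (∑ k : SubIdx m, (∫⁻ y in subCell ℓ k, (‖Ψ (Matrix.vecCons y X)‖₊ : ℝ≥0∞) ^ 2) ^ 2) /
            (∫⁻ y, (‖Ψ (Matrix.vecCons y X)‖₊ : ℝ≥0∞) ^ 2)
        ≤ ∫⁻ X : Config n,
          ((∑ k : SubIdx m, (∫⁻ y in subCell ℓ k, (‖Φ (Matrix.vecCons y X)‖₊ : ℝ≥0∞) ^ 2) ^ 2) /
              (∫⁻ y, (‖Φ (Matrix.vecCons y X)‖₊ : ℝ≥0∞) ^ 2) +
            2 * ∫⁻ y : Space, (‖Ψ (Matrix.vecCons y X) - Φ (Matrix.vecCons y X)‖₊ : ℝ≥0∞) *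
              ((‖Ψ (Matrix.vecCons y X)‖₊ : ℝ≥0∞) + ‖Φ (Matrix.vecCons y X)‖₊)) :=
          lintegral_mono fun X => hpt X
      _ = _ := by
          rw [lintegral_add_right _ hGs2, lintegral_const_mul _ hGs, ← lintegral_config_succ hGm]
  -- Cauchy–Schwarz: `∫ |Ψ − Φ| |g| ≤ η` for normalised `g`
  have hη2 : ENNReal.ofReal (η ^ 2) = ENNReal.ofReal η ^ 2 := ENNReal.ofReal_pow hη 2
  have hCS : ∀ g : Config (n + 1) → ℂ, Measurable g → ∫⁻ Z, (‖g Z‖₊ : ℝ≥0∞) ^ 2 = 1 →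
      ∫⁻ Z, (‖Ψ Z - Φ Z‖₊ : ℝ≥0∞) * ‖g Z‖₊ ≤ ENNReal.ofReal η := by
    intro g hg hg1
    have h := lintegral_mul_sq_le volume hD.aemeasurable hg.nnnorm.coe_nnreal_ennreal.aemeasurable
    rw [hg1, mul_one] at h
    exact (ENNReal.pow_le_pow_left_iff two_ne_zero).1 (h.trans (hclose.trans_eq hη2))
  have hGint : ∫⁻ Z, (‖Ψ Z - Φ Z‖₊ : ℝ≥0∞) * ((‖Ψ Z‖₊ : ℝ≥0∞) + ‖Φ Z‖₊) ≤
      ENNReal.ofReal η + ENNReal.ofReal η := by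
    calc ∫⁻ Z, (‖Ψ Z - Φ Z‖₊ : ℝ≥0∞) * ((‖Ψ Z‖₊ : ℝ≥0∞) + ‖Φ Z‖₊)
        = ∫⁻ Z, ((‖Ψ Z - Φ Z‖₊ : ℝ≥0∞) * ‖Ψ Z‖₊ + (‖Ψ Z - Φ Z‖₊ : ℝ≥0∞) * ‖Φ Z‖₊) :=
          lintegral_congr fun Z => mul_add _ _ _
      _ = (∫⁻ Z, (‖Ψ Z - Φ Z‖₊ : ℝ≥0∞) * ‖Ψ Z‖₊) + ∫⁻ Z, (‖Ψ Z - Φ Z‖₊ : ℝ≥0∞) * ‖Φ Z‖₊ :=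
          lintegral_add_left (hD.mul hNΨ) _
      _ ≤ ENNReal.ofReal η + ENNReal.ofReal η := add_le_add (hCS Ψ hΨm hΨ1) (hCS Φ hΦm hΦ1)
  -- the constant: `m³ · 2 · 2η = 4 m³ η ≤ 8 m³ η`
  have hfin : (m : ℝ≥0∞) ^ 3 * (2 * ∫⁻ Z, (‖Ψ Z - Φ Z‖₊ : ℝ≥0∞) * ((‖Ψ Z‖₊ : ℝ≥0∞) + ‖Φ Z‖₊)) ≤
      ENNReal.ofReal (8 * (m : ℝ) ^ 3 * η) := by
    have h2η : (2 : ℝ≥0∞) * (ENNReal.ofReal η + ENNReal.ofReal η) = ENNReal.ofReal (4 * η) := by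
      rw [two_mul, ← ENNReal.ofReal_add hη hη, ← ENNReal.ofReal_add (by positivity) (by positivity)]
      congr 1
      ring
    have hm3 : (m : ℝ≥0∞) ^ 3 = ENNReal.ofReal ((m : ℝ) ^ 3) := by
      rw [ENNReal.ofReal_pow (Nat.cast_nonneg _), ENNReal.ofReal_natCast]
    have hmη : 0 ≤ (m : ℝ) ^ 3 * η := mul_nonneg (by positivity) hη
    calc (m : ℝ≥0∞) ^ 3 * (2 * ∫⁻ Z, (‖Ψ Z - Φ Z‖₊ : ℝ≥0∞) * ((‖Ψ Z‖₊ : ℝ≥0∞) + ‖Φ Z‖₊))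
        ≤ (m : ℝ≥0∞) ^ 3 * (2 * (ENNReal.ofReal η + ENNReal.ofReal η)) :=
          mul_le_mul_right (mul_le_mul_right hGint 2) _
      _ = ENNReal.ofReal ((m : ℝ) ^ 3 * (4 * η)) := by
          rw [h2η, hm3, ← ENNReal.ofReal_mul (by positivity)]
      _ ≤ ENNReal.ofReal (8 * (m : ℝ) ^ 3 * η) := ENNReal.ofReal_le_ofReal (by nlinarith)
  -- assemble
  refine (mul_le_mul_right hint _).trans ?_
  rw [mul_add]
  exact add_le_add le_rfl hfin

end SliceLipschitz

/-- **S1b — the coarse RH₂ slice functional is `L²`-Lipschitz, given S1a** (registered stub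
`stub_sliceLipschitz_of` of line `registered` of crux `CoarseGrainedReverseHolder`). For a trial state
`Ψ` of `n+1` bosons in a box of side `L`, a normalised measurable `Φ` and `‖Ψ − Φ‖₂ ≤ η` (`η ≥ 0`):
`F_{n,ℓ}(Ψ) ≤ F_{n,ℓ}(Φ) + 8 m³ η` at every resolution `m`, where
`F_{n,ℓ}(Ψ) = m³ ∫ dX̂ Σ_k (∫_{Q_k} |Ψ(y, X̂)|² dy)² / ∫ |Ψ(y, X̂)|² dy` over the `m³` cubes `Q_k` of side
`L/m`. The cubes are the sub-cells `BoseGas.subCell (L/m) k`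
(`CoarseRH2.setOf_forall_mem_Ico_eq_subCell`) and the claim is `SliceLipschitz.coarseRH2_lipschitz`. -/
theorem stub_sliceLipschitz_of :
    (∀ (ι : Type) [Fintype ι] (a b : ι → ENNReal) (A B : ENNReal),
      ∑ k, a k ≤ A → ∑ k, b k ≤ B →
      (∑ k, a k ^ 2) / A ≤ (∑ k, b k ^ 2) / B + (2 * ∑ k, (a k - b k) + (B - A))) →
    ∀ (n : ℕ) (L η : ℝ), 0 ≤ η →
    ∀ (Ψ : BoseGas.TrialState (n + 1) L) (Φ : BoseGas.Config (n + 1) → ℂ), Measurable Φ →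
      ∫⁻ X, (‖Φ X‖₊ : ENNReal) ^ 2 = 1 →
      ∫⁻ X, (‖Ψ.ψ X - Φ X‖₊ : ENNReal) ^ 2 ≤ ENNReal.ofReal (η ^ 2) →
      ∀ (m : ℕ),
      (m : ENNReal) ^ 3 * ∫⁻ X : Fin n → EuclideanSpace ℝ (Fin 3),
          ((∑ k : Fin 3 → Fin m,
              (∫⁻ y in {y : EuclideanSpace ℝ (Fin 3) |
                  ∀ i, y i ∈ Set.Ico ((k i : ℝ) * (L / m)) (((k i : ℝ) + 1) * (L / m))},
                (‖Ψ.ψ (Matrix.vecCons y X)‖₊ : ENNReal) ^ 2) ^ 2) /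
            (∫⁻ y, (‖Ψ.ψ (Matrix.vecCons y X)‖₊ : ENNReal) ^ 2))
        ≤ ((m : ENNReal) ^ 3 * ∫⁻ X : Fin n → EuclideanSpace ℝ (Fin 3),
              ((∑ k : Fin 3 → Fin m,
                  (∫⁻ y in {y : EuclideanSpace ℝ (Fin 3) |
                      ∀ i, y i ∈ Set.Ico ((k i : ℝ) * (L / m)) (((k i : ℝ) + 1) * (L / m))},
                    (‖Φ (Matrix.vecCons y X)‖₊ : ENNReal) ^ 2) ^ 2) /
                (∫⁻ y, (‖Φ (Matrix.vecCons y X)‖₊ : ENNReal) ^ 2)))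
          + ENNReal.ofReal (8 * (m : ℝ) ^ 3 * η) := by
  intro hS1a n L η hη Ψ Φ hΦm hΦ1 hclose m
  simp only [CoarseRH2.setOf_forall_mem_Ico_eq_subCell]
  exact SliceLipschitz.coarseRH2_lipschitz hS1a (L / m) m hη Ψ.contDiff.continuous.measurable hΦm
    Ψ.norm_eq hΦ1 hclose

end Summit.AtomisticToContinuum.BoseEinsteinCondensation.Theorems.CoarseGrainedReverseHolder

end
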